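import Summits.CriticalPhenomena.PercolationContinuityZ3.Theorems.Transplant.SkelCellsConcG
import HarnessLib

/-!
# L3.1 (part 3) + L3.2: `ExitGeom`, `StepsGeom`, `LevelGeom` (with the level shift) and `QSepGeom` for the cell geometry of record
# `Skel.cellGeomSG` over a `PlanarSkeletonConc` (companion of `SkelCellsConcG`, which holds the geometry, `WFS`, `RunGeom`, `AnchGeom`,
# `SepGeom`, `SepGeom₂`)

builds on p205010 (kernel theorem, internal audit signed; external expert review pending) — nothing in this file uses p205010.
Lane `prim-bschramm-*`, seat `prim-bschramm-p2` (gen 3); helper file (`--supports stmt-CriticalPhenomena-4575`).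

* **`exitGeomSG`** (`locFin` from `lip` + hp-8's `sub_cen_le_of_mem_EwvN`), **`stepsGeomSG`** (corridor ⊆ `Q ∪ EfarN` by the step device);
* `lev_le_lev_add_one_of_adj`, `mem_VStair_Stub_of_adj`, `mem_VWin_EfarN_of_adj` — the two "inside edge stays inside" facts behind the level shift;
* **`levelGeomSG`** (`L j = 5r + 10sj − 1`, `ℓQ = 5r + 1`; the three separations from hp-8's `BtwN_sepInf_EfarN` / `Cell_sepInf_EfarN` /
  `Zone_sepInf_EfarN`), **`qSepGeomSG`** (`Cell_sepInf_Q`, `Zone_sepInf_Q`).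
Hypotheses: `WFS C Λ` only (no `φ w₀ = 0` here).
[cite: KozmaNitzan2024, §4 pp. 26–27, 30–31 (E_{v,x}, H^j_{v,x}, F^j_{v,x}; Step IV)] [cite: GrimmettPercolation1999, §7.2]
-/

noncomputable section

open scoped Classical

namespace Summit.CriticalPhenomena.PercolationContinuityZ3.Theorems

namespace Transplant

namespace Skel

open Literature.Probability.Percolation Literature.Probability.LatticeModels SimpleGraph KNCells PlanarSkeletonConc
open Literature.Probability.Percolation.KozmaNitzan.Cells (oth oth_ne sgOf sgOf_sign stepVec_apply_fst stepVec_apply_oth eq_oth_of_ne oth_oth)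
open Literature.Barriers.CriticalPhenomena (graphBall graphBall_finite mem_graphBall_self graphBall_mono)
open BoxProdZ2 (ConcRadiiG)

variable {V : Type} [DecidableEq V] {G : SimpleGraph V} [G.LocallyFinite] (Φ : PlanarSkeletonConc G)

section Records

variable (C : PCells) (w₀ : V) {Λ : ConcRadiiG} (hΛ : WFS C Λ)

/-! ## §5 `ExitGeom`, `StepsGeom` -/

include hΛ in
/-- **`ExitGeom`** (`locFin` from `lip`: a neighbour of `y` inside `E_{w,δ}` pins the macro-vertex `w + δ` within `35r + 1` of `φ y`).
[cite: KozmaNitzan2024, §4 pp. 26–27] -/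
theorem exitGeomSG : ExitGeom G (cellGeomSG Φ C w₀ Λ) where
  M_subset_Q a v := VWin_mono (C.M_subset_Q v) (hΛ.wf.MQ a v)
  Cell_disjoint_Q a a' u x hux := disjoint_VWin (C.Cell_disjoint_Q hux) _ _
  Zone_disjoint_Q a a' u δ x := disjoint_VWin (C.Zone_disjoint_Q u δ x) _ _
  locFin y := by
    set B : Site 2 := fun i => |Φ.φ y i| + 35 * C.r + 1 with hB
    refine (Finset.Icc (-B) B).finite_toSet.subset ?_
    rintro v ⟨a, w, δ, rfl, b, hb, hadj⟩
    change b ∈ Φ.VWin w₀ (C.BtwN w δ) (Λ.rB a w δ) ∪ Φ.VWin w₀ (C.Q (w + stepVec δ)) (Λ.rQ a (w + stepVec δ)) at hb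
    have hb2 : Φ.φ b ∈ C.EwvN w δ := by
      rw [PCells.EwvN, Finset.mem_union]
      rcases Finset.mem_union.1 hb with h | h
      · exact Or.inl (φ_mem_of_mem_VWin h)
      · exact Or.inr (φ_mem_of_mem_VWin h)
    have hnear : ∀ i, |Φ.φ b i - Φ.φ y i| ≤ 1 := fun i => by
      rw [abs_sub_comm]; exact Φ.lip hadj i
    rw [Finset.coe_Icc, Set.mem_Icc]
    have key : ∀ i, |(w + stepVec δ) i| ≤ B i := by
      intro i
      have h1 := C.sub_cen_le_of_mem_EwvN hb2 i
      have h2 := hnear i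
      rw [abs_le] at h1 h2 ⊢
      simp only [PCells.cen_apply] at h1
      simp only [hB]
      have hy := abs_nonneg (Φ.φ y i)
      have hy' := le_abs_self (Φ.φ y i)
      have hy'' := neg_abs_le (Φ.φ y i)
      have hr : (1 : ℤ) ≤ C.r := by exact_mod_cast C.one_le_r
      constructor <;> nlinarith
    exact ⟨fun i => (abs_le.1 (key i)).1, fun i => (abs_le.1 (key i)).2⟩

include hΛ in
/-- **`StepsGeom`** (faces ⊆ stubs ⊆ corridor; corridor ⊆ `Q_a ∪ EfarN_{a'}` by the step device; target cube ⊆ far box).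
[cite: KozmaNitzan2024, §4 pp. 26, 30] -/
theorem stepsGeomSG : StepsGeom (cellGeomSG Φ C w₀ Λ) (faceDataSG Φ C w₀ Λ) where
  Face_subset_Stub _ _ _ _ := Finset.filter_subset _ _
  Stub_subset_Hfull a v δ j hj := VStair_mono (C.Stub_subset_Hfull v δ (by change j ≤ C.K at hj; exact hj)) fun _ _ => le_rfl
  Hfull_subset a a' v δ ha' := by
    intro y hy
    change y ∈ Φ.VStair w₀ (C.Hfull v δ) (prof C Λ a' v δ) at hy
    change y ∈ Φ.VWin w₀ (C.Q v) (Λ.rQ a v) ∪ Φ.VWin w₀ (C.EfarN v δ) (Λ.rE a' v δ)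
    obtain ⟨hP, hd⟩ := mem_of_mem_VStair hy
    rcases Finset.mem_union.1 (C.Hfull_subset_Q_union_EfarN v δ hP) with h | h
    · exact Finset.mem_union_left _
        (Φ.mem_VWin_of_zdAdj hd (hΛ.ρQ1 a a' v δ _ ha' (C.lev_le_of_mem_Q h)) h (C.exists_adj_of_mem_Q v h))
    · exact Finset.mem_union_right _ (Φ.mem_VWin_of_zdAdj hd (hΛ.ρE1 a' v δ _) h (C.exists_adj_of_mem_EfarN v δ h))
  M_tgt_subset_Efar a v δ := VWin_mono (C.M_add_stepVec_subset_EfarN v δ) (hΛ.wf.ME a v δ)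

/-! ## §6 `LevelGeom` (with the level shift) and `QSepGeom` -/

omit [DecidableEq V] in
/-- Along an edge of `G` the level moves by at most one (`lip`). [folklore] -/
theorem lev_le_lev_add_one_of_adj (C : PCells) {δ : MDir} (v : Site 2) {y z : V} (h : G.Adj y z) :
    C.lev δ v (Φ.φ z) ≤ C.lev δ v (Φ.φ y) + 1 :=
  C.lev_le_lev_add_one_of_abs_sub_le_one v (by rw [abs_sub_comm]; exact Φ.lip h δ.1)

/-- An inside edge of the corridor staircase starting at level `≤ 5r + 10sj − 1` is an inside edge of the stub staircase `H^j` (`j ≤ K`):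
both endpoints have level `≤ 5r + 10sj`. [this work] -/
theorem mem_VStair_Stub_of_adj {C : PCells} {w₀ : V} {ρ : Site 2 → ℕ} {v : Site 2} {δ : MDir} {j : ℕ} {y z : V}
    (hy : y ∈ Φ.stair w₀ (C.Hfull v δ) ρ) (hz : z ∈ Φ.stair w₀ (C.Hfull v δ) ρ) (hadj : G.Adj y z)
    (hl : C.lev δ v (Φ.φ y) ≤ 5 * (C.r : ℤ) + 10 * (C.s : ℤ) * j - 1) : y ∈ Φ.VStair w₀ (C.Stub v δ j) ρ := by
  rw [Φ.mem_stair] at hy hz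
  have hlz : C.lev δ v (Φ.φ z) ≤ 5 * C.r + 10 * C.s * j := by have := lev_le_lev_add_one_of_adj Φ C v hadj (δ := δ); omega
  refine (mem_vspan_edgesIn_of_adj ?_ ?_ hadj).1
  · exact Φ.mem_stair.2 ⟨C.mem_Stub_of_mem_Hfull hy.1 (by omega), hy.2⟩
  · exact Φ.mem_stair.2 ⟨C.mem_Stub_of_mem_Hfull hz.1 hlz, hz.2⟩

/-- An inside edge of a staircase over `H` (or `H^j`, `j ≤ K`) starting at level `≥ 5r + 2` is an inside edge of the window over `EfarN`
(profile `≤ rE`). [this work] -/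
theorem mem_VWin_EfarN_of_adj {C : PCells} {w₀ : V} {Λ : ConcRadiiG} (hW : Λ.WF C) {a : ℕ} {v : Site 2} {δ : MDir} {P : Finset (Site 2)}
    (hPH : P ⊆ C.Hfull v δ) {y z : V} (hy : y ∈ Φ.stair w₀ P (prof C Λ a v δ)) (hz : z ∈ Φ.stair w₀ P (prof C Λ a v δ)) (hadj : G.Adj y z)
    (hl : 5 * (C.r : ℤ) + 2 ≤ C.lev δ v (Φ.φ y)) : y ∈ Φ.VWin w₀ (C.EfarN v δ) (Λ.rE a v δ) := by
  rw [Φ.mem_stair] at hy hz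
  have hlz : 5 * (C.r : ℤ) + 1 ≤ C.lev δ v (Φ.φ z) := by
    have := lev_le_lev_add_one_of_adj Φ C v hadj.symm (δ := δ); omega
  have hyE : Φ.φ y ∈ C.EfarN v δ := by
    by_contra hn; have := C.lev_le_of_mem_Hfull_not_EfarN' (hPH hy.1) hn; omega
  have hzE : Φ.φ z ∈ C.EfarN v δ := by
    by_contra hn; have := C.lev_le_of_mem_Hfull_not_EfarN' (hPH hz.1) hn; omega
  refine (mem_vspan_edgesIn_of_adj ?_ ?_ hadj).1
  · exact Φ.mem_Win.2 ⟨graphBall_mono G w₀ (hW.ρE a v δ _) hy.2, hyE⟩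
  · exact Φ.mem_Win.2 ⟨graphBall_mono G w₀ (hW.ρE a v δ _) hz.2, hzE⟩

include hΛ in
/-- **`LevelGeom`** over a planar skeleton with the narrow boxes and the level shift. [cite: KozmaNitzan2024, §4 p. 31 (Step IV)] -/
theorem levelGeomSG : LevelGeom G (cellGeomSG Φ C w₀ Λ) (faceDataSG Φ C w₀ Λ) (levelDataS Φ C) where
  adj_le a' v δ y z h := lev_le_lev_add_one_of_adj Φ C v h
  lev_Q a a' v δ _ y hy := by
    change C.lev δ v (Φ.φ y) ≤ 5 * (C.r : ℤ) + 1
    have := C.lev_le_of_mem_Q (δ := δ) (φ_mem_of_mem_VWin hy); omega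
  lev_Hfull a' v δ y hy hn := by
    change C.lev δ v (Φ.φ y) ≤ 5 * (C.r : ℤ) + 1
    change y ∉ Φ.VWin w₀ (C.EfarN v δ) (Λ.rE a' v δ) at hn
    by_contra hlt
    obtain ⟨hyS, z, hz, hadj⟩ := mem_vspan_edgesIn_iff.1 hy
    exact hn (mem_VWin_EfarN_of_adj Φ hΛ.wf subset_rfl hyS hz hadj (by omega))
  ℓQ_lt j hj := by
    change 5 * (C.r : ℤ) + 1 < 5 * (C.r : ℤ) + 10 * (C.s : ℤ) * j - 1
    have hs1 : (1 : ℤ) ≤ C.s := by exact_mod_cast C.hs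
    have : (1 : ℤ) ≤ j := by exact_mod_cast hj
    nlinarith
  mem_Stub a' v δ j _ _ y hy hl := by
    obtain ⟨hyS, z, hz, hadj⟩ := mem_vspan_edgesIn_iff.1 hy
    exact mem_VStair_Stub_of_adj Φ hyS hz hadj hl
  mem_Face a' v δ j _ _ y hy hl := by
    obtain ⟨hyS, z, hz, hadj⟩ := mem_vspan_edgesIn_iff.1 hy
    exact Finset.mem_filter.2 ⟨mem_VStair_Stub_of_adj Φ hyS hz hadj hl.le, hl⟩
  Face_far a' v δ j hjK t ht := by
    obtain ⟨htS, hl⟩ := Finset.mem_filter.1 ht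
    have hs1 : (1 : ℤ) ≤ C.s := by exact_mod_cast C.hs
    refine ⟨?_, ?_⟩
    · change t ∈ Φ.VWin w₀ (C.EfarN v δ) (Λ.rE a' v δ)
      obtain ⟨htS', z, hz, hadj⟩ := mem_vspan_edgesIn_iff.1 htS
      refine mem_VWin_EfarN_of_adj Φ hΛ.wf (C.Stub_subset_Hfull v δ hjK) htS' hz hadj ?_
      rw [hl]; push_cast; nlinarith
    · change 5 * (C.r : ℤ) + 10 * (C.s : ℤ) * j - 1 + 1 ≤ C.lev δ v (Φ.φ t)
      rw [hl]; push_cast; nlinarith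
  M_far a' v δ t ht := by
    have hl := C.lev_ge_of_mem_M_add (δ := δ) (φ_mem_of_mem_VWin ht)
    have hrK : (C.r : ℤ) = C.K * C.s := by simp [PCells.r]
    refine ⟨VWin_mono (C.M_add_stepVec_subset_EfarN v δ) (hΛ.wf.ME a' v δ) ht, ?_⟩
    change 5 * (C.r : ℤ) + 10 * (C.s : ℤ) * (C.K : ℕ) - 1 + 1 ≤ C.lev δ v (Φ.φ t)
    nlinarith
  Btw_sep_Efar a a' w δw du hdu := by
    change KNCells.Sep G (Φ.VWin w₀ (C.BtwN w δw) (Λ.rB a w δw)) (Φ.VWin w₀ (C.EfarN (w + stepVec δw) du) (Λ.rE a' (w + stepVec δw) du))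
    rw [← C.BtwN_rev' w δw]
    exact sep_VWin_of_sepInf (C.BtwN_sepInf_EfarN (w + stepVec δw) (Ne.symm hdu)) _ _
  Cell_sep_Efar b a' u v δ huv hux := sep_VWin_of_sepInf (C.Cell_sepInf_EfarN huv hux) _ _
  Zone_sep_Efar b a' u δ' v δ huv hux := sep_VWin_of_sepInf (C.Zone_sepInf_EfarN huv hux δ') _ _

/-- **`QSepGeom`** (cells and zones of other macro-vertices against the cube; wide boxes, gaps `5r`, `10s`). [cite: KozmaNitzan2024, §4 p. 26 ((29))] -/
theorem qSepGeomSG : QSepGeom G (cellGeomSG Φ C w₀ Λ) where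
  Cell_sep_Q _ _ _ _ hux := sep_VWin_of_sepInf (C.Cell_sepInf_Q hux) _ _
  Zone_sep_Q _ _ u δ x _ := sep_VWin_of_sepInf (C.Zone_sepInf_Q u δ x) _ _

end Records

end Skel

end Transplant

end Summit.CriticalPhenomena.PercolationContinuityZ3.Theorems

end
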